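import Mathlib
import Literature.Computability.Complexity.ExtMonotoneGates
import Literature.Computability.Complexity.CliqueApproximatorsWide
import Literature.Computability.Complexity.RossmanMonotoneCliqueProb
import Summits.PneNP.PneNP.Theses.ConvexRankGates

/-!
# drefute gen 2 — `SGAt` is EXACTLY a statement about "explaining" small sets (Lean, 0 sorry)

For the lead of line `dnf-invariant-wide-gates-see-small-cliques` (crux stmt-PneNP-10681), stubs
`stub_sgPerm` / `stub_sgGRank`. Definitions `atomB`, `IsTermGate`, `lostPos`, `gainedNeg`, `SGAt` are
VERBATIM copies of the skeleton's §2 (the Lines file is not an importable module); inside the skeleton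
the theorems below paste into §3 unchanged.

* `explSets m l q η O = {X ∈ 𝒱(l) : Pr_q[O = 0 ∧ ⌈X⌉] ≤ η}` — the small sets that "explain" `O` up to `η`
  (planting `K_X` leaves rejection mass `≤ η`; note `Pr[O = 0 ∧ ⌈X⌉] = q^{#E(K_X)} · Pr[O(G ∪ K_X) = 0]`).
* NECESSITY `subset_explSets_of_gainedNeg_le`, `lostPos_explSets_le_of_sgWitness`: every SG witness `𝒜`
  lies inside `explSets ε`, hence `#lostPos O (explSets ε) ≤ #lostPos O 𝒜 ≤ ε·C(m,k)`.
  So `not_sgAt_of_lostPos_explSets` : `ε·C(m,k) < #lostPos O (explSets ε)` ⇒ `¬ SGAt` — this contains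
  gen-0's detector criterion (`not_sgAt_of_detector`: there `explSets ε = ∅`).
* SUFFICIENCY `gainedNeg_explSets_le` (union bound `prob_exists_le`): `gainedNeg O (explSets η) ≤ #𝒱(l)·η`,
  hence `sgGoal_of_lostPos_explSets_le`: `#lostPos O (explSets (ε / #𝒱(l))) ≤ ε·C(m,k)` ⇒ the SG goal for `O`
  (with the witness `𝒜 := explSets (ε/#𝒱(l))`, which is moreover the LARGEST admissible family at that level).
So, up to the factor `#𝒱(l)` in the level, `SGAt` for `O` says: the bare `k`-cliques accepted by `O` through
NO explaining small subset are at most `ε·C(m,k)`. A refutation of `stub_sgPerm`/`stub_sgGRank` is therefore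
exactly: a term gate `O` and `> ε·C(m,k)` accepted `k`-sets `S` such that for EVERY `X ⊆ S`, `X ∈ 𝒱(l)`:
`Pr[O(G(m,q) ∪ K_X) = 0] > ε / q^{#E(K_X)}` (`≤ 2ε`).

* `atomFamily l Y = {W ∈ 𝒱(l) : Y ⊆ W}`, `isClosedFamily_atomFamily` (closed for `r ≥ 2`, `Y ∈ 𝒱(l)`),
  `accepts_atomFamily_iff` (`⌈atomFamily l Y⌉ = ⌈Y⌉`): the EXACT closed approximator of an atom input — the
  base case of the reduction "SG(O) for every term gate O of small monotone AND-complexity over its atoms"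
  recorded in the accompanying note (stubs/SG-sharpening.md, §3).
-/

set_option linter.dupNamespace false

namespace Summit.PneNP.PneNP.Cruxes.LinAlgGateBlind.DnfInvariantWideGatesSeeSmallCliques.DrefuteG2

open Finset Literature.Computability.Complexity Razborov

noncomputable section

/-! ### Verbatim copies of the skeleton's §2 definitions -/

open Classical in
/-- (copy of the skeleton's `atomB`) -/
def atomB {m : ℕ} (X : Finset (Fin m)) (x : KEdge m → Bool) : Bool := decide (CliquePresent X x)

/-- (copy of the skeleton's `IsTermGate`) -/
def IsTermGate (m : ℕ) (P : GateFn → Prop) (l : ℕ) (O : (KEdge m → Bool) → Bool) : Prop :=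
  ∃ g : GateFn, P g ∧ ∃ X : Fin g.1 → Finset (Fin m),
    (∀ a, X a ∈ smallSets (Fin m) l) ∧ ∀ x, O x = g.2 (fun a => atomB (X a) x)

open Classical in
/-- (copy of the skeleton's `lostPos`) -/
def lostPos (m k : ℕ) (O : (KEdge m → Bool) → Bool) (𝒜 : Finset (Finset (Fin m))) :
    Finset (Finset (Fin m)) :=
  (powersetCard k (univ : Finset (Fin m))).filter fun S =>
    O (cliqueVec S) = true ∧ ¬ Accepts 𝒜 (cliqueVec S)

/-- (copy of the skeleton's `gainedNeg`) -/
def gainedNeg (m : ℕ) (q : ℝ) (O : (KEdge m → Bool) → Bool) (𝒜 : Finset (Finset (Fin m))) : ℝ :=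
  prob q (fun x : KEdge m → Bool => O x = false ∧ Accepts 𝒜 x)

/-- (copy of the skeleton's `SGAt`) -/
def SGAt (m : ℕ) (P : GateFn → Prop) (l k : ℕ) (q ε : ℝ) : Prop :=
  ∀ O : (KEdge m → Bool) → Bool, IsTermGate m P l O →
    ∃ 𝒜 ⊆ smallSets (Fin m) l,
      (#(lostPos m k O 𝒜) : ℝ) ≤ ε * (m.choose k : ℝ) ∧ gainedNeg m q O 𝒜 ≤ ε

/-- (copy of the skeleton's `lostPos_anti`) Enlarging the family can only shrink the lost positives. -/
theorem lostPos_anti {m k : ℕ} (O : (KEdge m → Bool) → Bool) {𝒜 ℬ : Finset (Finset (Fin m))}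
    (h : 𝒜 ⊆ ℬ) : lostPos m k O ℬ ⊆ lostPos m k O 𝒜 := by
  intro S hS
  simp only [lostPos, mem_filter] at hS ⊢
  exact ⟨hS.1, hS.2.1, fun hacc => hS.2.2 (hacc.mono h)⟩

/-! ### Explaining sets -/

open Classical in
/-- **Explaining sets at level `η`.** `explSets m l q η O`: the small vertex sets `X ∈ 𝒱(l)` with
`Pr_{G ∼ G(m,q)}[O(G) = 0 ∧ K_X ⊆ G] ≤ η` — planting the small clique `K_X` leaves `O` rejecting with
mass at most `η`. [folklore] -/
def explSets (m l : ℕ) (q η : ℝ) (O : (KEdge m → Bool) → Bool) : Finset (Finset (Fin m)) :=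
  (smallSets (Fin m) l).filter fun X =>
    prob q (fun x : KEdge m → Bool => O x = false ∧ CliquePresent X x) ≤ η

theorem explSets_subset (m l : ℕ) (q η : ℝ) (O : (KEdge m → Bool) → Bool) :
    explSets m l q η O ⊆ smallSets (Fin m) l := by
  classical
  exact filter_subset _ _

open Classical in
theorem mem_explSets {m l : ℕ} {q η : ℝ} {O : (KEdge m → Bool) → Bool} {X : Finset (Fin m)} :
    X ∈ explSets m l q η O ↔ X ∈ smallSets (Fin m) l ∧
      prob q (fun x : KEdge m → Bool => O x = false ∧ CliquePresent X x) ≤ η := by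
  simp [explSets]

/-- Explaining sets are monotone in the level. -/
theorem explSets_mono {m l : ℕ} {q η η' : ℝ} (h : η ≤ η') (O : (KEdge m → Bool) → Bool) :
    explSets m l q η O ⊆ explSets m l q η' O := by
  intro X hX
  rw [mem_explSets] at hX ⊢
  exact ⟨hX.1, hX.2.trans h⟩

/-- A single member of `𝒜` is gained at least as much as the event `[O = 0 ∧ ⌈X⌉]`. -/
theorem prob_single_le_gainedNeg {m : ℕ} {q : ℝ} (hq0 : 0 ≤ q) (hq1 : q ≤ 1)
    (O : (KEdge m → Bool) → Bool) {𝒜 : Finset (Finset (Fin m))} {X : Finset (Fin m)} (hX : X ∈ 𝒜) :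
    prob q (fun x : KEdge m → Bool => O x = false ∧ CliquePresent X x) ≤ gainedNeg m q O 𝒜 := by
  unfold gainedNeg
  exact prob_mono hq0 hq1 fun x hx => ⟨hx.1, X, hX, hx.2⟩

/-- **Necessity, part 1.** Any family with gained mass `≤ ε` consists of `ε`-explaining sets. -/
theorem subset_explSets_of_gainedNeg_le {m l : ℕ} {q ε : ℝ} (hq0 : 0 ≤ q) (hq1 : q ≤ 1)
    (O : (KEdge m → Bool) → Bool) {𝒜 : Finset (Finset (Fin m))} (h𝒜 : 𝒜 ⊆ smallSets (Fin m) l)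
    (hgain : gainedNeg m q O 𝒜 ≤ ε) : 𝒜 ⊆ explSets m l q ε O := by
  intro X hX
  rw [mem_explSets]
  exact ⟨h𝒜 hX, (prob_single_le_gainedNeg hq0 hq1 O hX).trans hgain⟩

/-- **Necessity, part 2.** An SG witness `𝒜` forces `#lostPos O (explSets ε) ≤ ε·C(m,k)`: the family of ALL
`ε`-explaining sets loses no more than `𝒜 ⊆ explSets ε` does. -/
theorem lostPos_explSets_le_of_sgWitness {m l k : ℕ} {q ε : ℝ} (hq0 : 0 ≤ q) (hq1 : q ≤ 1)
    (O : (KEdge m → Bool) → Bool) {𝒜 : Finset (Finset (Fin m))} (h𝒜 : 𝒜 ⊆ smallSets (Fin m) l)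
    (hlost : (#(lostPos m k O 𝒜) : ℝ) ≤ ε * (m.choose k : ℝ)) (hgain : gainedNeg m q O 𝒜 ≤ ε) :
    (#(lostPos m k O (explSets m l q ε O)) : ℝ) ≤ ε * (m.choose k : ℝ) := by
  refine le_trans ?_ hlost
  exact_mod_cast card_le_card (lostPos_anti O (subset_explSets_of_gainedNeg_le hq0 hq1 O h𝒜 hgain))

/-- **Refutation criterion (sharp form).** If a single term gate `O` accepts more than `ε·C(m,k)` bare
`k`-cliques that contain NO `ε`-explaining small set, then `SGAt` fails. (Gen-0's `not_sgAt_of_detector`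
is the case `explSets ε = ∅`.) -/
theorem not_sgAt_of_lostPos_explSets {m : ℕ} {P : GateFn → Prop} {l k : ℕ} {q ε : ℝ} (hq0 : 0 ≤ q)
    (hq1 : q ≤ 1) (O : (KEdge m → Bool) → Bool) (hO : IsTermGate m P l O)
    (hbig : ε * (m.choose k : ℝ) < (#(lostPos m k O (explSets m l q ε O)) : ℝ)) :
    ¬ SGAt m P l k q ε := by
  intro hSG
  obtain ⟨𝒜, h𝒜, hlost, hgain⟩ := hSG O hO
  exact absurd (lostPos_explSets_le_of_sgWitness hq0 hq1 O h𝒜 hlost hgain) (not_le.2 hbig)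

/-- **Sufficiency, part 1 (union bound).** The family of all `η`-explaining sets gains at most `#𝒱(l)·η`
(`η ≥ 0`). -/
theorem gainedNeg_explSets_le {m l : ℕ} {q η : ℝ} (hq0 : 0 ≤ q) (hq1 : q ≤ 1) (hη : 0 ≤ η)
    (O : (KEdge m → Bool) → Bool) :
    gainedNeg m q O (explSets m l q η O) ≤ (#(smallSets (Fin m) l) : ℝ) * η := by
  classical
  unfold gainedNeg
  calc prob q (fun x : KEdge m → Bool => O x = false ∧ Accepts (explSets m l q η O) x)
      = prob q (fun x : KEdge m → Bool =>
          ∃ X ∈ explSets m l q η O, O x = false ∧ CliquePresent X x) :=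
        prob_congr fun x => ⟨fun ⟨hO, X, hX, hXx⟩ => ⟨X, hX, hO, hXx⟩,
          fun ⟨X, hX, hO, hXx⟩ => ⟨hO, X, hX, hXx⟩⟩
    _ ≤ ∑ X ∈ explSets m l q η O,
          prob q (fun x : KEdge m → Bool => O x = false ∧ CliquePresent X x) :=
        prob_exists_le hq0 hq1 _ _
    _ ≤ ∑ X ∈ explSets m l q η O, η := sum_le_sum fun X hX => (mem_explSets.1 hX).2
    _ = (#(explSets m l q η O) : ℝ) * η := by rw [sum_const, nsmul_eq_mul]
    _ ≤ (#(smallSets (Fin m) l) : ℝ) * η :=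
        mul_le_mul_of_nonneg_right (by exact_mod_cast card_le_card (explSets_subset m l q η O)) hη

/-- **Sufficiency, part 2.** If the bare `k`-cliques accepted by `O` through NO `(ε/#𝒱(l))`-explaining small
subset are at most `ε·C(m,k)`, then the SG goal holds for `O`, with witness `explSets (ε/#𝒱(l))`. -/
theorem sgGoal_of_lostPos_explSets_le {m l k : ℕ} {q ε : ℝ} (hq0 : 0 ≤ q) (hq1 : q ≤ 1) (hε : 0 ≤ ε)
    (O : (KEdge m → Bool) → Bool)
    (hlost : (#(lostPos m k O (explSets m l q (ε / #(smallSets (Fin m) l)) O)) : ℝ)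
      ≤ ε * (m.choose k : ℝ)) :
    ∃ 𝒜 ⊆ smallSets (Fin m) l,
      (#(lostPos m k O 𝒜) : ℝ) ≤ ε * (m.choose k : ℝ) ∧ gainedNeg m q O 𝒜 ≤ ε := by
  refine ⟨explSets m l q (ε / #(smallSets (Fin m) l)) O, explSets_subset _ _ _ _ _, hlost, ?_⟩
  have hcard : (0 : ℝ) < #(smallSets (Fin m) l) := by
    exact_mod_cast card_pos.2 ⟨∅, empty_mem_smallSets l⟩
  calc gainedNeg m q O (explSets m l q (ε / #(smallSets (Fin m) l)) O)
      ≤ (#(smallSets (Fin m) l) : ℝ) * (ε / #(smallSets (Fin m) l)) :=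
        gainedNeg_explSets_le hq0 hq1 (div_nonneg hε hcard.le) O
    _ = ε := mul_div_cancel₀ ε (ne_of_gt hcard)

/-- **The sandwich, SG-level.** `SGAt` follows from the explaining-sets count at level `ε/#𝒱(l)` for every
term gate, and implies it at level `ε`. -/
theorem sgAt_of_forall_lostPos_explSets_le {m : ℕ} {P : GateFn → Prop} {l k : ℕ} {q ε : ℝ}
    (hq0 : 0 ≤ q) (hq1 : q ≤ 1) (hε : 0 ≤ ε)
    (h : ∀ O : (KEdge m → Bool) → Bool, IsTermGate m P l O →
      (#(lostPos m k O (explSets m l q (ε / #(smallSets (Fin m) l)) O)) : ℝ) ≤ ε * (m.choose k : ℝ)) :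
    SGAt m P l k q ε := fun O hO => sgGoal_of_lostPos_explSets_le hq0 hq1 hε O (h O hO)

theorem forall_lostPos_explSets_le_of_sgAt {m : ℕ} {P : GateFn → Prop} {l k : ℕ} {q ε : ℝ}
    (hq0 : 0 ≤ q) (hq1 : q ≤ 1) (hSG : SGAt m P l k q ε) :
    ∀ O : (KEdge m → Bool) → Bool, IsTermGate m P l O →
      (#(lostPos m k O (explSets m l q ε O)) : ℝ) ≤ ε * (m.choose k : ℝ) := by
  intro O hO
  obtain ⟨𝒜, h𝒜, hlost, hgain⟩ := hSG O hO
  exact lostPos_explSets_le_of_sgWitness hq0 hq1 O h𝒜 hlost hgain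

/-! ### The exact closed approximator of an atom input (base case of the AND-complexity reduction) -/

/-- `atomFamily l Y = {W ∈ 𝒱(l) : Y ⊆ W}`, the principal up-set of `Y` inside `𝒱(l)` (the tree's
`inputFamily l e` is the case `Y = e`). [folklore] -/
def atomFamily {m : ℕ} (l : ℕ) (Y : Finset (Fin m)) : Finset (Finset (Fin m)) :=
  (smallSets (Fin m) l).filter fun W => Y ⊆ W

theorem mem_atomFamily {m l : ℕ} {Y W : Finset (Fin m)} :
    W ∈ atomFamily l Y ↔ W ∈ smallSets (Fin m) l ∧ Y ⊆ W := by
  simp [atomFamily]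

/-- The principal up-set of a small set is closed in `K(m, r, l)` for `r ≥ 2` (two of the implying sets
contain `Y`, hence so does their intersection and the implied set; if the implied set has `≤ 1` element then
`Y = ∅` because singletons are not in `𝒱(l)`, and `canon U = ∅ ⊇ Y`). -/
theorem isClosedFamily_atomFamily {m r l : ℕ} (hr : 2 ≤ r) {Y : Finset (Fin m)}
    (hY : Y ∈ smallSets (Fin m) l) : IsClosedFamily r l (atomFamily l Y) := by
  classical
  refine ⟨filter_subset _ _, fun U hUl hI => ?_⟩
  obtain ⟨W, hW, hWU⟩ := hI
  set i0 : Fin r := ⟨0, by omega⟩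
  set i1 : Fin r := ⟨1, by omega⟩
  have h0 : Y ⊆ W i0 := (mem_atomFamily.1 (hW i0)).2
  have h1 : Y ⊆ W i1 := (mem_atomFamily.1 (hW i1)).2
  have hsub : W i0 ∩ W i1 ⊆ U := hWU i0 i1 (by simp [i0, i1, Fin.ext_iff])
  have hYU : Y ⊆ U := fun a ha => hsub (mem_inter.2 ⟨h0 ha, h1 ha⟩)
  rw [mem_atomFamily]
  refine ⟨canon_mem_smallSets hUl, ?_⟩
  by_cases hU1 : #U ≤ 1
  · rw [canon_eq_empty hU1]
    have hY1 : #Y ≠ 1 := (mem_smallSets.1 hY).2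
    have hYle : #Y ≤ 1 := (card_le_card hYU).trans hU1
    have hY0 : Y = ∅ := by rw [← card_eq_zero]; omega
    rw [hY0]
  · rw [canon_eq_self (by omega)]
    exact hYU

/-- The principal up-set of `Y ∈ 𝒱(l)` accepts exactly the graphs containing the clique on `Y`. -/
theorem accepts_atomFamily_iff {m l : ℕ} {Y : Finset (Fin m)} (hY : Y ∈ smallSets (Fin m) l)
    (x : KEdge m → Bool) : Accepts (atomFamily l Y) x ↔ CliquePresent Y x := by
  constructor
  · rintro ⟨W, hW, hWx⟩
    exact hWx.anti (mem_atomFamily.1 hW).2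
  · intro h
    exact ⟨Y, mem_atomFamily.2 ⟨hY, Subset.rfl⟩, h⟩

open Classical in
/-- As Booleans: `⌈atomFamily l Y⌉ = atomB Y`. -/
theorem decide_accepts_atomFamily {m l : ℕ} {Y : Finset (Fin m)} (hY : Y ∈ smallSets (Fin m) l)
    (x : KEdge m → Bool) : decide (Accepts (atomFamily l Y) x) = atomB Y x := by
  unfold atomB
  rw [decide_eq_decide]
  exact accepts_atomFamily_iff hY x

end

end Summit.PneNP.PneNP.Cruxes.LinAlgGateBlind.DnfInvariantWideGatesSeeSmallCliques.DrefuteG2
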